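import Summits.NavierStokesRegularity.NavierStokesRegularity.Theorems.QuantisedSymmetryPolyhedralDssProfileExistsStubSmoothRepresentativeAe
import Summits.NavierStokesRegularity.NavierStokesRegularity.Theorems.QuantisedSymmetryPolyhedralDssProfileExistsStubTransportAe
import Summits.NavierStokesRegularity.NavierStokesRegularity.Theorems.QuantisedSymmetryPolyhedralDssProfileExistsStubClassicalOfOseenMildPast
import Literature.Analysis.FluidPDE.ChaeWolfRemovingDSSProofs
import HarnessLib

/-!
# The period window on the crux — crux stmt-NavierStokesRegularity-1404 (`QuantisedSymmetry.PolyhedralDssProfileExists`),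
  line polyhedral_cell, stub stub_periodWindow (N1)

Registered stub `stub_periodWindow` (`--supports stmt-NavierStokesRegularity-1404`), a NECESSARY
CONDITION on witnesses of the crux X⁻, stated on the crux's own variables: Chae–Wolf 2017,
Theorem 1.3 — for every Type-I constant `C₀ > 0` there is `c₁ = c₁(C₀) > 1` such that every ancient
mild solution `u` of 3-D Navier–Stokes in the tree's duality form (`IsAncientMildSolution 1 u`,
measurable slices) which is exactly `c`-DSS with `1 < c < c₁` (`IsDiscretelySelfSimilar c u`,
`c • u (c² t) (c • x) = u t x`) and obeys the Type-I bound `‖u(t, x)‖ ≤ C₀/(‖x‖ + √(−t))`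
(`HasTypeIDecay C₀ u`) has all its negative slices a.e. zero. Hence every witness `(G, c, u)` of
the crux with Type-I constant `C₀` has `c ≥ c₁(C₀)`: the DSS factor cannot be too close to `1`.
No symmetry enters.

Proof (assembly of landed tree theorems).
1. `stub_smoothRepresentative_ae` (p156260): the Oseen-gauge representative `V` of `u`,
   `IsTypeIAncientMild C V`, `HasTypeIDecay C₀ V`, `V t = u t` a.e. for every `t < 0`, `V t = 0`
   for `t ≥ 0`.
2. `stub_transport_ae` (p155960) with the trivial group `G = ⊥`: exact `c`-DSS passes to `V`.
3. `exists_isClassicalNSSolutionOn_Iio_of_isTypeIAncientMild` (p152134): `V` is a classical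
   Navier–Stokes solution on `(−∞, 0)` for some smooth pressure `p`.
4. The DISCHARGED named fact `chaeWolf2017_removing_dss_holds` (Chae–Wolf 2017, Thm 1.3) kills
   `V` on the past for `1 < c < c₁(C₀)`; then `u t = V t = 0` a.e.
-/

noncomputable section

-- the summit namespace `…NavierStokesRegularity.NavierStokesRegularity…` is the tree convention (D-0017)
set_option linter.dupNamespace false

namespace Summit.NavierStokesRegularity.NavierStokesRegularity.Theorems.PolyhedralDssProfileExists.PolyhedralCell

open MeasureTheory Set Function Filter Topology
open Literature.Analysis Literature.Analysis.FluidPDE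

/-- **Every field is equivariant under the trivial subgroup `⊥` of the linear isometries**: the only
element is the identity. [folklore] -/
private theorem equivariant_bot
    (u : ℝ → EuclideanSpace ℝ (Fin 3) → EuclideanSpace ℝ (Fin 3)) :
    ∀ g ∈ (⊥ : Subgroup (EuclideanSpace ℝ (Fin 3) ≃ₗᵢ[ℝ] EuclideanSpace ℝ (Fin 3))),
      ∀ t x, u t (g x) = g (u t x) := by
  intro g hg t x
  rw [Subgroup.mem_bot] at hg
  subst hg
  rfl

/-- **REGISTERED NECESSARY CONDITION `stub_periodWindow` (N1): the period window on the crux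
(Chae–Wolf 2017, Theorem 1.3, on the crux's own variables).** For every `C₀ > 0` there is `c₁ > 1`
such that every ancient mild solution `u` (duality form `IsAncientMildSolution 1 u`, measurable
slices) which is exactly `c`-DSS with `1 < c < c₁` and obeys the Type-I bound
`‖u(t, x)‖ ≤ C₀/(‖x‖ + √(−t))` has `u t = 0` a.e. for every `t < 0`. Proof: the Oseen-gauge
representative `V` (`stub_smoothRepresentative_ae`) is exactly `c`-DSS (`stub_transport_ae` with
`G = ⊥`), classical on the past for some pressure
(`exists_isClassicalNSSolutionOn_Iio_of_isTypeIAncientMild`), and keeps the Type-I bound with the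
same constant `C₀`, so the discharged fact `chaeWolf2017_removing_dss_holds` gives `V ≡ 0` on the
past; `u t = V t = 0` a.e. [cite: ChaeWolf2017RemovingDSS, Theorem 1.3] -/
theorem stub_periodWindow :
    ∀ C₀ : ℝ, 0 < C₀ → ∃ c₁ : ℝ, 1 < c₁ ∧
      ∀ (c : ℝ) (u : ℝ → EuclideanSpace ℝ (Fin 3) → EuclideanSpace ℝ (Fin 3)), 1 < c → c < c₁ →
        IsAncientMildSolution 1 u → (∀ t < 0, AEStronglyMeasurable (u t) volume) →
        IsDiscretelySelfSimilar c u → HasTypeIDecay C₀ u → ∀ t < 0, u t =ᵐ[volume] 0 := by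
  intro C₀ hC₀
  obtain ⟨c₁, hc₁, hcw⟩ := chaeWolf2017_removing_dss_holds C₀ hC₀
  refine ⟨c₁, hc₁, ?_⟩
  intro c u hc hcc₁ hanc hmeas hdss hdec t ht
  -- (1) the Oseen-gauge representative
  obtain ⟨V, C, hV, hdecV, hae, hzero⟩ := stub_smoothRepresentative_ae u C₀ hanc hmeas hdec
  -- (2) exact DSS passes to the representative (trivial group)
  obtain ⟨hdssV, -⟩ := stub_transport_ae ⊥ c u V C hc hdss (equivariant_bot u) hV hae hzero
  -- (3) the representative is classical on the past for some pressure
  obtain ⟨p, hcl⟩ := exists_isClassicalNSSolutionOn_Iio_of_isTypeIAncientMild hV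
  -- (4) Chae–Wolf 2017, Thm 1.3 kills the representative on the past
  have hVz : ∀ s < 0, ∀ x, V s x = 0 := hcw c hc hcc₁ V p hcl hdssV hdecV
  have hVt : V t = (0 : EuclideanSpace ℝ (Fin 3) → EuclideanSpace ℝ (Fin 3)) := funext (hVz t ht)
  rw [← hVt]
  exact (hae t ht).symm

end Summit.NavierStokesRegularity.NavierStokesRegularity.Theorems.PolyhedralDssProfileExists.PolyhedralCell

end
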